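import Literature.Computability.Complexity.ProofComplexityProofs
import HarnessLib

/-!
# A scaffold for building polynomial-size extended Frege proofs

Infrastructure for *constructing* extended Frege (`EF`) proofs of explicitly bounded size over
an arbitrary finite list `G` of sound schematic rules (`FregeSystem`, `Frege.lean`), as needed
for discharging facts of the form "the tautologies `τₘ` have polynomial-size `EF`-proofs"
(e.g. `Literature.Barriers.PneNP.RSAPairDisjointnessEFProofs`, the proof-complexity half of
Krajíček–Pudlák's Cor. 10). By the rule-by-rule translation
`FregeSystem.exists_translationEF` (`ProofComplexityProofs.lean`; Cook–Reckhow 1979, Thm. 2.3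
and §4) such proofs transfer, with polynomial overhead, to extended Frege over *every* Frege
system, so the constructing side may use any convenient finite list of sound rules: here every
constant-size inference step is one rule, whose soundness is established by a truth-table check.

## Content

* `PropForm.eval_congr_vars`, `PropForm.bound` (a strict bound for the variables of a formula),
  `PropForm.bigAnd` (conjunction of a list) with semantics and size.
* `FregeRule.check`, `FregeRule.isSound_of_check`: a concrete rule is sound as soon as the
  Boolean truth-table check over all assignments to its metavariables (`allAssign`) returns
  `true` (to be evaluated by `decide +kernel`).
* `FregeSystem.IsInferredFrom` (one inference with premises in a *set*), `FregeSystem.IsBlock`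
  (a segment each of whose lines is available, repeated, or inferred from available and earlier
  lines) with `IsBlock.append` (sequential composition), `IsBlock.mono`, `IsBlock.mono_rules`;
  `FregeSystem.IsRelaxedEF` (inferred lines, extension axioms, repetitions — the hypothesis of
  the pruning lemma `exists_isEFDerivation_of_relaxed`) with `IsRelaxedEF.append_block` and the
  packaging `IsRelaxedEF.exists_isEFProofOf` into a genuine `IsEFProofOf` of no larger size.
* `FregeSystem.extAxioms`, `FregeSystem.IsExtList`: extension axioms `p ↔ ψ` allocated with
  increasing fresh variables above a bound are admissible (`isRelaxedEF_extAxioms`).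
* The refutation scaffold `Scaffold.*` for targets `Φ = ¬⋀T₀ ∨ ¬⋀T₁` (the shape `¬φ ∨ ψ` of
  interpolation statements, `φ = ⋀T₀`, `ψ = ¬⋀T₁`): a context variable `κ` abbreviates `Φ`
  (extension axiom `κ ↔ Φ`), the constraints become available as lines `κ ∨ c`
  (`c ∈ T₀ ++ T₁`), further abbreviations `E` as `κ ∨ (p ↔ χ)`; the user supplies a block over
  this available set `Scaffold.Avail` containing `κ ∨ ⊥`, and `Scaffold.exists_isEFProofOf_le`
  returns an `EF`-proof of `Φ` of size `≤ Scaffold.sizeBound T₀ T₁ E + proofSize D`.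

## Sources

* S. A. Cook, R. A. Reckhow, *The relative efficiency of propositional proof systems*,
  J. Symbolic Logic 44 (1979): §2 (Frege rules, soundness, derivations; proof of Thm. 2.3:
  blocks "with hypotheses deleted"), §4, Def. 4.1 (extension axioms and their freshness
  conditions).
* J. Krajíček, *Bounded arithmetic, propositional logic, and complexity theory* (CUP 1995),
  Def. 4.5.2 (extended Frege proofs), Lemma 4.4.9–4.4.10 (instances of fixed schemes, the
  deduction lemma — the role played here by the context variable).
* S. R. Buss, *An introduction to proof theory* (Handbook of Proof Theory, 1998), §1.1.

## Design notes

* Lines of a proof under construction are kept small by working under a context: every working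
  line is `K ∨ L` with `K` the context (the variable `κ`, or `κ ∨ ¬A₁ ∨ ⋯` inside a case
  analysis) and `L` of constant size; rules are stated with a context metavariable `var 0`.
* Matching a rule against available lines is definitional: premise and conclusion instances
  `p.subst (sub [t₀, t₁, …])` reduce to the explicit formulas, so `IsInferredFrom.of_rule hr σ
  rfl (prems_cons h₁ (prems_cons h₂ prems_nil))` is the idiom for one step.
* Nothing here is specific to one tautology family; the arithmetic netlists and their laws are
  in `EFNetlist.lean` and its sequels.
-/

namespace Literature.Computability.Complexity.PropForm

universe u

variable {ν : Type u}

/-- The truth value of a formula only depends on the values of its variables.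
[cite: Buss1998, §1.1] -/
theorem eval_congr_vars [DecidableEq ν] {σ τ : ν → Bool} {φ : PropForm ν}
    (h : ∀ v ∈ φ.vars, σ v = τ v) : φ.eval σ = φ.eval τ := by
  induction φ with
  | var v => simpa [eval, vars] using h v (by simp [vars])
  | const b => rfl
  | neg φ ih => simp only [eval, ih (fun v hv => h v (by simpa [vars] using hv))]
  | conj φ ψ ihφ ihψ =>
    simp only [eval, ihφ (fun v hv => h v (by simp [vars, hv])),
      ihψ (fun v hv => h v (by simp [vars, hv]))]
  | disj φ ψ ihφ ihψ =>
    simp only [eval, ihφ (fun v hv => h v (by simp [vars, hv])),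
      ihψ (fun v hv => h v (by simp [vars, hv]))]

/-- A strict upper bound for the (natural-number) variables of a formula. [folklore] -/
def bound : PropForm ℕ → ℕ
  | var x => x + 1
  | const _ => 0
  | neg φ => φ.bound
  | conj φ ψ => max φ.bound ψ.bound
  | disj φ ψ => max φ.bound ψ.bound

/-- Every variable of `φ` is below `φ.bound`. [folklore] -/
theorem lt_bound_of_mem_vars {φ : PropForm ℕ} {x : ℕ} (h : x ∈ φ.vars) : x < φ.bound := by
  induction φ with
  | var v =>
    simp only [vars, Finset.mem_singleton] at h
    simp [bound, h]
  | const b => simp [vars] at h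
  | neg φ ih => exact ih (by simpa [vars] using h)
  | conj φ ψ ihφ ihψ =>
    simp only [vars, Finset.mem_union] at h
    simp only [bound, lt_max_iff]
    exact h.imp ihφ ihψ
  | disj φ ψ ihφ ihψ =>
    simp only [vars, Finset.mem_union] at h
    simp only [bound, lt_max_iff]
    exact h.imp ihφ ihψ

/-- `bound` is the least strict upper bound: if all variables are `< b` then `bound ≤ b`.
[folklore] -/
theorem bound_le_of_forall_lt {φ : PropForm ℕ} {b : ℕ} (h : ∀ x ∈ φ.vars, x < b) : φ.bound ≤ b := by
  induction φ with
  | var v => exact h v (by simp [vars])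
  | const c => exact Nat.zero_le b
  | neg φ ih => exact ih (fun x hx => h x (by simpa [vars] using hx))
  | conj φ ψ ihφ ihψ =>
    exact max_le (ihφ fun x hx => h x (by simp [vars, hx])) (ihψ fun x hx => h x (by simp [vars, hx]))
  | disj φ ψ ihφ ihψ =>
    exact max_le (ihφ fun x hx => h x (by simp [vars, hx])) (ihψ fun x hx => h x (by simp [vars, hx]))

/-- The conjunction of a list of formulas, `⋀ [c₁, …, c_k] = c₁ ∧ (c₂ ∧ (⋯ ∧ ⊤))`.
[folklore] -/
def bigAnd : List (PropForm ν) → PropForm ν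
  | [] => const true
  | c :: l => conj c (bigAnd l)

/-- Semantics of the big conjunction. [folklore] -/
theorem eval_bigAnd (σ : ν → Bool) (l : List (PropForm ν)) :
    (bigAnd l).eval σ = l.all (fun c => c.eval σ) := by
  induction l with
  | nil => rfl
  | cons c l ih => simp [bigAnd, eval, ih]

/-- The big conjunction is true iff all conjuncts are. [folklore] -/
theorem eval_bigAnd_eq_true {σ : ν → Bool} {l : List (PropForm ν)} :
    (bigAnd l).eval σ = true ↔ ∀ c ∈ l, c.eval σ = true := by
  rw [eval_bigAnd, List.all_eq_true]

/-- Size of the big conjunction: the sizes of the conjuncts plus one node each, plus one.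
[folklore] -/
theorem size_bigAnd (l : List (PropForm ν)) :
    (bigAnd l).size = (l.map size).sum + l.length + 1 := by
  induction l with
  | nil => rfl
  | cons c l ih =>
    simp only [bigAnd, size, ih, List.map_cons, List.sum_cons, List.length_cons]
    omega

/-- Variables of the big conjunction. [folklore] -/
theorem mem_vars_bigAnd [DecidableEq ν] {l : List (PropForm ν)} {x : ν} :
    x ∈ (bigAnd l).vars ↔ ∃ c ∈ l, x ∈ c.vars := by
  induction l with
  | nil => simp [bigAnd, vars]
  | cons c l ih => simp [bigAnd, vars, ih]

end Literature.Computability.Complexity.PropForm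

namespace Literature.Computability.MetaComplexity

open _root_.Computability Complexity Complexity.PropForm

/-! ### A truth-table soundness checker for concrete rules -/

/-- All assignments to the variables `< V` (extended by `false`), as a list of `2^V`
functions. [folklore] -/
def allAssign : ℕ → List (ℕ → Bool)
  | 0 => [fun _ => false]
  | V + 1 => (allAssign V).flatMap fun f =>
      [fun i => if i = V then false else f i, fun i => if i = V then true else f i]

/-- Every assignment agrees below `V` with one of `allAssign V`. [folklore] -/
theorem exists_mem_allAssign (σ : ℕ → Bool) :
    ∀ V : ℕ, ∃ f ∈ allAssign V, ∀ i < V, f i = σ i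
  | 0 => ⟨fun _ => false, List.mem_singleton.2 rfl, fun i hi => absurd hi (Nat.not_lt_zero i)⟩
  | V + 1 => by
    obtain ⟨f, hf, hfi⟩ := exists_mem_allAssign σ V
    refine ⟨fun i => if i = V then σ V else f i, ?_, fun i hi => ?_⟩
    · rw [allAssign, List.mem_flatMap]
      refine ⟨f, hf, ?_⟩
      cases σ V <;> simp
    · by_cases hiV : i = V
      · simp [hiV]
      · simp only [if_neg hiV]
        exact hfi i (by omega)

namespace FregeRule

/-- A strict upper bound for the metavariables of a rule. [folklore] -/
def bound (r : FregeRule) : ℕ :=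
  ((r.conclusion :: r.premises).map PropForm.bound).foldr max 0

/-- Every metavariable of a rule is below its bound. [folklore] -/
theorem lt_bound {r : FregeRule} {ψ : PropForm ℕ} (hψ : ψ ∈ r.conclusion :: r.premises)
    {x : ℕ} (hx : x ∈ ψ.vars) : x < r.bound := by
  unfold bound
  generalize r.conclusion :: r.premises = l at hψ
  induction l with
  | nil => simp at hψ
  | cons χ l ih =>
    simp only [List.map_cons, List.foldr_cons, lt_max_iff]
    rcases List.mem_cons.1 hψ with rfl | h
    · exact Or.inl (lt_bound_of_mem_vars hx)
    · exact Or.inr (ih h)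

/-- Truth-table check of the soundness of a concrete rule over the assignments to its
metavariables. [cite: CookReckhow1979, §2 (sound rule)] -/
def check (r : FregeRule) : Bool :=
  (allAssign r.bound).all fun f => !(r.premises.all fun p => p.eval f) || r.conclusion.eval f

/-- **A rule passing the truth-table check is sound** (its conclusion is a consequence of its
premises under every assignment, the check covering all assignments to its metavariables).
[cite: CookReckhow1979, §2 (sound rule)] -/
theorem isSound_of_check {r : FregeRule} (h : r.check = true) : r.IsSound := by
  intro σ hprem
  obtain ⟨f, hf, hfσ⟩ := exists_mem_allAssign σ r.bound
  have hagree : ∀ ψ ∈ r.conclusion :: r.premises, ψ.eval f = ψ.eval σ := fun ψ hψ =>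
    eval_congr_vars fun v hv => hfσ v (lt_bound hψ hv)
  have hall := List.all_eq_true.1 h f hf
  have hp : (r.premises.all fun p => p.eval f) = true := List.all_eq_true.2 fun p hp => by
    rw [hagree p (List.mem_cons_of_mem _ hp)]
    exact hprem p hp
  rw [hp] at hall
  rw [← hagree r.conclusion List.mem_cons_self]
  simpa using hall

end FregeRule

/-! ### Blocks: derivation segments from a set of available formulas -/

namespace FregeSystem

variable {F G : FregeSystem}

/-- `F.IsInferredFrom S θ`: `θ` follows by one rule of `F` from premise instances lying in the
*set* `S` (cf. `IsInferred`, where the premises are earlier lines of a list).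
[cite: CookReckhow1979, §2 (inference by a substitution instance of a rule)] -/
def IsInferredFrom (F : FregeSystem) (S : Set (PropForm ℕ)) (θ : PropForm ℕ) : Prop :=
  ∃ r ∈ F.rules, ∃ σ : ℕ → PropForm ℕ, r.conclusion.subst σ = θ ∧ ∀ p ∈ r.premises, p.subst σ ∈ S

/-- `IsInferred` is `IsInferredFrom` the set of earlier lines. [folklore] -/
theorem isInferred_iff_isInferredFrom {prev : List (PropForm ℕ)} {θ : PropForm ℕ} :
    F.IsInferred prev θ ↔ F.IsInferredFrom {χ | χ ∈ prev} θ :=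
  Iff.rfl

/-- Inferences are monotone in the available set. [folklore] -/
theorem IsInferredFrom.mono {S T : Set (PropForm ℕ)} {θ : PropForm ℕ} (h : F.IsInferredFrom S θ)
    (hST : S ⊆ T) : F.IsInferredFrom T θ := by
  obtain ⟨r, hr, σ, hc, hp⟩ := h
  exact ⟨r, hr, σ, hc, fun p hpp => hST (hp p hpp)⟩

/-- Inferences are monotone in the rule list. [folklore] -/
theorem IsInferredFrom.mono_rules {S : Set (PropForm ℕ)} {θ : PropForm ℕ}
    (h : F.IsInferredFrom S θ) (hFG : ∀ r ∈ F.rules, r ∈ G.rules) : G.IsInferredFrom S θ := by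
  obtain ⟨r, hr, σ, hc, hp⟩ := h
  exact ⟨r, hFG r hr, σ, hc, hp⟩

/-- A one-step inference by a rule of `F` under a substitution `σ` whose premise instances are
available. [cite: CookReckhow1979, §2] -/
theorem isInferredFrom_rule {S : Set (PropForm ℕ)} {r : FregeRule} (hr : r ∈ F.rules)
    (σ : ℕ → PropForm ℕ) (hp : ∀ p ∈ r.premises, p.subst σ ∈ S) :
    F.IsInferredFrom S (r.conclusion.subst σ) :=
  ⟨r, hr, σ, rfl, hp⟩

/-- A one-step inference by a rule of `F`, with the conclusion instance stated explicitly (to be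
checked by `rfl`) and the premise instances to be found in `S`. [cite: CookReckhow1979, §2] -/
theorem IsInferredFrom.of_rule {S : Set (PropForm ℕ)} {r : FregeRule} (hr : r ∈ F.rules)
    (σ : ℕ → PropForm ℕ) {θ : PropForm ℕ} (hθ : r.conclusion.subst σ = θ)
    (hp : ∀ p ∈ r.premises, p.subst σ ∈ S) : F.IsInferredFrom S θ :=
  hθ ▸ ⟨r, hr, σ, rfl, hp⟩

/-- Premise obligations, empty list. [folklore] -/
theorem prems_nil {P : PropForm ℕ → Prop} : ∀ q ∈ ([] : List (PropForm ℕ)), P q :=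
  fun _ h => absurd h List.not_mem_nil

/-- Premise obligations, one premise at a time. [folklore] -/
theorem prems_cons {P : PropForm ℕ → Prop} {p : PropForm ℕ} {ps : List (PropForm ℕ)} (h : P p)
    (hs : ∀ q ∈ ps, P q) : ∀ q ∈ p :: ps, P q :=
  List.forall_mem_cons.2 ⟨h, hs⟩

/-- Substitution given by a list of values for the metavariables `0, 1, …` (the constant `⊤`
elsewhere). [folklore] -/
def sub (l : List (PropForm ℕ)) (i : ℕ) : PropForm ℕ :=
  l.getD i (const true)

/-- `F.IsBlock Γ D`: the segment `D` is a *block over the available set* `Γ` — every line of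
`D` lies in `Γ`, repeats an earlier line of `D`, or is inferred by a rule of `F` from formulas
in `Γ` or earlier in `D`. Blocks are the unit in which long extended Frege proofs are
assembled; repeated lines are pruned at the end (`exists_isEFDerivation_of_relaxed`).
[cite: CookReckhow1979, Thm. 2.3 (proof)] -/
def IsBlock (F : FregeSystem) (Γ : Set (PropForm ℕ)) (D : List (PropForm ℕ)) : Prop :=
  ∀ (k : ℕ) (hk : k < D.length), D[k] ∈ Γ ∪ {χ | χ ∈ D.take k} ∨
    F.IsInferredFrom (Γ ∪ {χ | χ ∈ D.take k}) D[k]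

/-- The empty block. [folklore] -/
theorem IsBlock.nil (F : FregeSystem) (Γ : Set (PropForm ℕ)) : F.IsBlock Γ [] :=
  fun k hk => absurd hk (Nat.not_lt_zero k)

/-- A one-line block: an available formula or an inference from available formulas.
[folklore] -/
theorem IsBlock.singleton {Γ : Set (PropForm ℕ)} {θ : PropForm ℕ}
    (h : θ ∈ Γ ∨ F.IsInferredFrom Γ θ) : F.IsBlock Γ [θ] := by
  intro k hk
  have hk0 : k = 0 := by simpa using hk
  subst hk0
  simp only [List.take_zero, List.not_mem_nil, Set.setOf_false, Set.union_empty,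
    List.getElem_cons_zero]
  exact h

/-- A single available formula is a block. [folklore] -/
theorem IsBlock.of_mem {Γ : Set (PropForm ℕ)} {θ : PropForm ℕ} (h : θ ∈ Γ) : F.IsBlock Γ [θ] :=
  IsBlock.singleton (Or.inl h)

/-- A single inference from available formulas is a block. [folklore] -/
theorem IsBlock.of_isInferredFrom {Γ : Set (PropForm ℕ)} {θ : PropForm ℕ}
    (h : F.IsInferredFrom Γ θ) : F.IsBlock Γ [θ] :=
  IsBlock.singleton (Or.inr h)

/-- Blocks are monotone in the available set. [folklore] -/
theorem IsBlock.mono {Γ Γ' : Set (PropForm ℕ)} {D : List (PropForm ℕ)} (h : F.IsBlock Γ D)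
    (hΓ : Γ ⊆ Γ') : F.IsBlock Γ' D := fun k hk =>
  (h k hk).imp (fun hm => Set.union_subset_union_left _ hΓ hm)
    fun hinf => hinf.mono (Set.union_subset_union_left _ hΓ)

/-- Blocks are monotone in the rule list. [folklore] -/
theorem IsBlock.mono_rules {Γ : Set (PropForm ℕ)} {D : List (PropForm ℕ)} (h : F.IsBlock Γ D)
    (hFG : ∀ r ∈ F.rules, r ∈ G.rules) : G.IsBlock Γ D := fun k hk =>
  (h k hk).imp id fun hinf => hinf.mono_rules hFG

/-- The lines available inside a concatenation, past the first part. [folklore] -/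
theorem avail_append {Γ : Set (PropForm ℕ)} {D₁ D₂ : List (PropForm ℕ)} {k : ℕ}
    (hle : D₁.length ≤ k) :
    Γ ∪ {χ | χ ∈ (D₁ ++ D₂).take k} = (Γ ∪ {χ | χ ∈ D₁}) ∪ {χ | χ ∈ D₂.take (k - D₁.length)} := by
  rw [List.take_append, List.take_of_length_le hle, Set.union_assoc]
  congr 1
  ext χ
  simp

/-- **Sequential composition of blocks**: a block over `Γ` followed by a block over `Γ`
together with the lines of the first is a block over `Γ`. [folklore] -/
theorem IsBlock.append {Γ : Set (PropForm ℕ)} {D₁ D₂ : List (PropForm ℕ)} (h₁ : F.IsBlock Γ D₁)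
    (h₂ : F.IsBlock (Γ ∪ {χ | χ ∈ D₁}) D₂) : F.IsBlock Γ (D₁ ++ D₂) := by
  intro k hk
  by_cases hk₁ : k < D₁.length
  · rw [List.getElem_append_left hk₁, List.take_append_of_le_length hk₁.le]
    exact h₁ k hk₁
  · have hle : D₁.length ≤ k := Nat.le_of_not_lt hk₁
    have hk₂ : k - D₁.length < D₂.length := by rw [List.length_append] at hk; omega
    rw [List.getElem_append_right hle, avail_append hle]
    exact h₂ (k - D₁.length) hk₂

/-- Appending one more line to a block. [folklore] -/
theorem IsBlock.snoc {Γ : Set (PropForm ℕ)} {D : List (PropForm ℕ)} {θ : PropForm ℕ}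
    (h : F.IsBlock Γ D)
    (hθ : θ ∈ Γ ∪ {χ | χ ∈ D} ∨ F.IsInferredFrom (Γ ∪ {χ | χ ∈ D}) θ) :
    F.IsBlock Γ (D ++ [θ]) :=
  h.append (IsBlock.singleton hθ)

/-- Prepending one line to a block. [folklore] -/
theorem IsBlock.cons {Γ : Set (PropForm ℕ)} {D : List (PropForm ℕ)} {θ : PropForm ℕ}
    (hθ : θ ∈ Γ ∨ F.IsInferredFrom Γ θ) (h : F.IsBlock (Γ ∪ {θ}) D) :
    F.IsBlock Γ (θ :: D) := by
  have := (IsBlock.singleton hθ).append (D₂ := D) (by simpa using h)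
  simpa using this

/-! ### Relaxed extended Frege sequences and their packaging into proofs -/

/-- `F.IsRelaxedEF φ L`: every line of `L` is inferred from earlier lines, is an extension
axiom (fresh w.r.t. the earlier lines and the target `φ`), or repeats an earlier line — the
hypothesis of the pruning lemma `exists_isEFDerivation_of_relaxed`.
[cite: CookReckhow1979, Def. 4.1] -/
def IsRelaxedEF (F : FregeSystem) (φ : PropForm ℕ) (L : List (PropForm ℕ)) : Prop :=
  ∀ (k : ℕ) (hk : k < L.length),
    F.IsInferred (L.take k) L[k] ∨ IsExtensionAxiom φ (L.take k) L[k] ∨ L[k] ∈ L.take k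

/-- A block over the lines of a relaxed sequence extends it to a relaxed sequence. [folklore] -/
theorem IsRelaxedEF.append_block {φ : PropForm ℕ} {L D : List (PropForm ℕ)}
    (hL : F.IsRelaxedEF φ L) (hD : F.IsBlock {χ | χ ∈ L} D) : F.IsRelaxedEF φ (L ++ D) := by
  intro k hk
  by_cases hk₁ : k < L.length
  · rw [List.getElem_append_left hk₁, List.take_append_of_le_length hk₁.le]
    exact hL k hk₁
  · have hle : L.length ≤ k := Nat.le_of_not_lt hk₁
    have hk₂ : k - L.length < D.length := by rw [List.length_append] at hk; omega
    have hset : {χ | χ ∈ L} ∪ {χ | χ ∈ D.take (k - L.length)} = {χ | χ ∈ (L ++ D).take k} := by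
      rw [List.take_append, List.take_of_length_le hle]
      ext χ
      simp
    rw [List.getElem_append_right hle]
    rcases hD (k - L.length) hk₂ with hm | hinf
    · rw [hset] at hm
      exact Or.inr (Or.inr hm)
    · rw [hset] at hinf
      exact Or.inl hinf

/-- **Packaging.** A relaxed sequence containing the target `φ` yields an extended Frege proof
of `φ` of no larger size (prune repetitions, `exists_isEFDerivation_of_relaxed`, and cut after
the first occurrence of `φ`). [cite: CookReckhow1979, Thm. 2.3 (proof)] [cite: CookReckhow1979, Def. 4.1] -/
theorem IsRelaxedEF.exists_isEFProofOf {φ : PropForm ℕ} {L : List (PropForm ℕ)}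
    (hL : F.IsRelaxedEF φ L) (hφ : φ ∈ L) :
    ∃ π : List (PropForm ℕ), F.IsEFProofOf π φ ∧ proofSize π ≤ proofSize L := by
  obtain ⟨L', hL', hmem, hsize⟩ := exists_isEFDerivation_of_relaxed hL
  obtain ⟨i, hi, hiφ⟩ := List.getElem_of_mem ((hmem φ).2 hφ)
  refine ⟨L'.take i ++ [φ], ⟨(hL'.take i).snoc ?_, by simp⟩, ?_⟩
  · have := hL' i hi
    rwa [hiφ] at this
  · have h := proofSize_take_le L' (i + 1)
    rw [List.take_succ_eq_append_getElem hi, hiφ] at h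
    exact h.trans hsize

/-! ### Extension prefixes: allocating abbreviations above all used variables -/

/-- The extension axioms `p ↔ ψ` of a list of definitions `(p, ψ)`.
[cite: CookReckhow1979, Def. 4.1] -/
def extAxioms (E : List (ℕ × PropForm ℕ)) : List (PropForm ℕ) :=
  E.map fun e => biimp (var e.1) e.2

/-- `IsExtList b E`: the definitions `(p, ψ)` of `E` are *well allocated above `b`*: the new
variables `p` are `≥ b`, strictly increasing along the list, and every body `ψ` only uses
variables below its own `p`. With `b` above all variables of the target formula this makes
`extAxioms E` a sequence of admissible extension axioms (`isRelaxedEF_extAxioms`).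
[cite: CookReckhow1979, Def. 4.1] [cite: Krajicek1995, Def 4.5.2] -/
def IsExtList (b : ℕ) (E : List (ℕ × PropForm ℕ)) : Prop :=
  (∀ e ∈ E, b ≤ e.1) ∧ E.Pairwise (fun e e' => e.1 < e'.1) ∧ ∀ e ∈ E, e.2.bound ≤ e.1

/-- Variables of a biimplication. [folklore] -/
theorem mem_vars_biimp {a b : PropForm ℕ} {x : ℕ} :
    x ∈ (biimp a b).vars ↔ x ∈ a.vars ∨ x ∈ b.vars := by
  simp only [biimp, vars, Finset.mem_union]
  tauto

/-- Size of a biimplication. [folklore] -/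
theorem size_biimp (a b : PropForm ℕ) : (biimp a b).size = 2 * a.size + 2 * b.size + 5 := by
  simp only [biimp, size]
  ring

/-- **Well-allocated definitions are admissible extension axioms**: if all variables of the
target `φ` are below `b` and `E` is well allocated above `b`, then `extAxioms E` is an
extended Frege derivation w.r.t. `φ` consisting of extension axioms only.
[cite: CookReckhow1979, Def. 4.1] [cite: Krajicek1995, Def 4.5.2] -/
theorem isRelaxedEF_extAxioms {φ : PropForm ℕ} {b : ℕ} {E : List (ℕ × PropForm ℕ)}
    (hφ : φ.bound ≤ b) (hE : IsExtList b E) : F.IsRelaxedEF φ (extAxioms E) := by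
  obtain ⟨hb, hpw, hbody⟩ := hE
  intro k hk
  rw [extAxioms, List.length_map] at hk
  refine Or.inr (Or.inl ⟨(E[k]).1, (E[k]).2, by simp [extAxioms], ?_, ?_, ?_⟩)
  · intro hx
    have := lt_bound_of_mem_vars hx
    have := hbody _ (List.getElem_mem hk)
    omega
  · intro hx
    have := lt_bound_of_mem_vars hx
    have := hb _ (List.getElem_mem hk)
    omega
  · intro χ hχ hx
    rw [extAxioms, ← List.map_take, List.mem_map] at hχ
    obtain ⟨e, he, rfl⟩ := hχ
    obtain ⟨i, hi, rfl⟩ := List.getElem_of_mem he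
    rw [List.length_take] at hi
    have hik : i < k := lt_of_lt_of_le hi (min_le_left _ _)
    have hiE : i < E.length := by omega
    rw [List.getElem_take] at hx
    have hlt : (E[i]).1 < (E[k]).1 := List.pairwise_iff_getElem.1 hpw i k hiE hk hik
    rcases mem_vars_biimp.1 hx with hx | hx
    · simp [vars] at hx
      omega
    · have := lt_bound_of_mem_vars hx
      have := hbody _ (List.getElem_mem hiE)
      omega

/-- Size of an extension prefix. [folklore] -/
theorem proofSize_extAxioms (E : List (ℕ × PropForm ℕ)) :
    proofSize (extAxioms E) = (E.map fun e => 2 * e.2.size + 7).sum := by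
  induction E with
  | nil => rfl
  | cons e E ih =>
    simp only [extAxioms, List.map_cons, proofSize, List.sum_cons, size_biimp, size] at ih ⊢
    rw [ih]
    ring

end FregeSystem

/-! ### The refutation scaffold

A proof of `Φ = ¬⋀T₀ ∨ ¬⋀T₁` (the shape `¬φ ∨ ψ` with `φ = ⋀T₀`, `ψ = ¬⋀T₁`, as needed for
interpolation statements) is organised as a refutation of the constraint lists `T₀`, `T₁`
under a *context variable* `κ` abbreviating `Φ` by the extension axiom `κ ↔ Φ`: every
working line has the shape `κ ∨ L` with `L` small, the constraints become available as the
lines `κ ∨ c` (`c ∈ T₀ ++ T₁`), every further abbreviation `p ↔ χ` as `κ ∨ (p ↔ χ)`, and a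
derived `κ ∨ ⊥` yields `κ`, hence `Φ`. The user of the scaffold supplies only a block over
the available set `ScaffoldAvail` ending in `κ ∨ ⊥`. -/

namespace Scaffold

open FregeSystem (sub)

/-- `∧`-elimination (right): `A ∧ B ⊢ B`. [cite: CookReckhow1979, §2] -/
def rConjR : FregeRule := ⟨[conj (var 1) (var 2)], var 2⟩
/-- `∧`-elimination (left): `A ∧ B ⊢ A`. [cite: CookReckhow1979, §2] -/
def rConjL : FregeRule := ⟨[conj (var 1) (var 2)], var 1⟩
/-- `K ∨ ¬(¬A ∨ ¬B) ⊢ K ∨ A`. [cite: CookReckhow1979, §2] -/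
def rNegDisjL : FregeRule := ⟨[disj (var 0) (neg (disj (neg (var 1)) (neg (var 2))))], disj (var 0) (var 1)⟩
/-- `K ∨ ¬(¬A ∨ ¬B) ⊢ K ∨ B`. [cite: CookReckhow1979, §2] -/
def rNegDisjR : FregeRule := ⟨[disj (var 0) (neg (disj (neg (var 1)) (neg (var 2))))], disj (var 0) (var 2)⟩
/-- `K ∨ (A ∧ B) ⊢ K ∨ A`. [cite: CookReckhow1979, §2] -/
def rCtxConjL : FregeRule := ⟨[disj (var 0) (conj (var 1) (var 2))], disj (var 0) (var 1)⟩
/-- `K ∨ (A ∧ B) ⊢ K ∨ B`. [cite: CookReckhow1979, §2] -/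
def rCtxConjR : FregeRule := ⟨[disj (var 0) (conj (var 1) (var 2))], disj (var 0) (var 2)⟩
/-- Weakening into the context: `A ⊢ K ∨ A`. [cite: CookReckhow1979, §2] -/
def rWeak : FregeRule := ⟨[var 1], disj (var 0) (var 1)⟩
/-- `K ∨ ⊥ ⊢ K`. [cite: CookReckhow1979, §2] -/
def rBot : FregeRule := ⟨[disj (var 0) (const false)], var 0⟩
/-- Modus ponens: `A, ¬A ∨ B ⊢ B`. [cite: CookReckhow1979, §2] -/
def rMP : FregeRule := ⟨[var 1, disj (neg (var 1)) (var 2)], var 2⟩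

/-- The rules used by the scaffold. [cite: CookReckhow1979, §2] -/
def rules : List FregeRule :=
  [rConjR, rConjL, rNegDisjL, rNegDisjR, rCtxConjL, rCtxConjR, rWeak, rBot, rMP]

/-- Every scaffold rule is sound (truth tables). [cite: CookReckhow1979, §2 (sound rule)] -/
theorem isSound_of_mem_rules : ∀ r ∈ rules, r.IsSound := by
  intro r hr
  simp only [rules, List.mem_cons, List.not_mem_nil, or_false] at hr
  rcases hr with rfl | rfl | rfl | rfl | rfl | rfl | rfl | rfl | rfl <;>
    exact FregeRule.isSound_of_check (by decide +kernel)

/-- The target formula `¬⋀T₀ ∨ ¬⋀T₁` of the refutation of the constraint lists `T₀, T₁`.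
[folklore] -/
def target (T₀ T₁ : List (PropForm ℕ)) : PropForm ℕ :=
  disj (neg (bigAnd T₀)) (neg (bigAnd T₁))

/-- Peeling a big conjunction under the context: the lines `κ ∨ c` and `κ ∨ ⋀rest` for the
successive conjuncts. [folklore] -/
def peel (κ : ℕ) : List (PropForm ℕ) → List (PropForm ℕ)
  | [] => []
  | c :: l => disj (var κ) c :: disj (var κ) (bigAnd l) :: peel κ l

/-- The lines of the scaffold after the extension axioms: unpacking `κ ↔ Φ` into the
constraints `κ ∨ c` and putting the user's abbreviations into the context. [folklore] -/
def prefixBlock (T₀ T₁ : List (PropForm ℕ)) (κ : ℕ) (E : List (ℕ × PropForm ℕ)) :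
    List (PropForm ℕ) :=
  disj (var κ) (neg (target T₀ T₁)) :: disj (var κ) (bigAnd T₀) :: disj (var κ) (bigAnd T₁) ::
    (peel κ T₀ ++ peel κ T₁ ++ E.map fun e => disj (var κ) (biimp (var e.1) e.2))

/-- The whole scaffold prefix: the extension axioms `κ ↔ Φ`, `p ↔ χ` (`(p, χ) ∈ E`), then
`prefixBlock`. [folklore] -/
def prefixLines (T₀ T₁ : List (PropForm ℕ)) (κ : ℕ) (E : List (ℕ × PropForm ℕ)) :
    List (PropForm ℕ) :=
  FregeSystem.extAxioms ((κ, target T₀ T₁) :: E) ++ prefixBlock T₀ T₁ κ E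

/-- The closing lines: `κ`, `¬κ ∨ Φ`, `Φ`. [folklore] -/
def suffixLines (T₀ T₁ : List (PropForm ℕ)) (κ : ℕ) : List (PropForm ℕ) :=
  [var κ, disj (neg (var κ)) (target T₀ T₁), target T₀ T₁]

/-- **The available set offered to the user of the scaffold**: the constraints `κ ∨ c`
(`c ∈ T₀ ++ T₁`) and the contextualised abbreviations `κ ∨ (p ↔ χ)` (`(p, χ) ∈ E`).
[folklore] -/
def Avail (T₀ T₁ : List (PropForm ℕ)) (κ : ℕ) (E : List (ℕ × PropForm ℕ)) : Set (PropForm ℕ) :=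
  {θ | ∃ c ∈ T₀ ++ T₁, θ = disj (var κ) c} ∪ {θ | ∃ e ∈ E, θ = disj (var κ) (biimp (var e.1) e.2)}

variable {G : FregeSystem}

/-- One inference by a scaffold rule, stated with an explicit conclusion. [folklore] -/
theorem infer {S : Set (PropForm ℕ)} (hG : ∀ r ∈ rules, r ∈ G.rules) (r : FregeRule)
    (hr : r ∈ rules) (σ : ℕ → PropForm ℕ) {θ : PropForm ℕ} (hθ : r.conclusion.subst σ = θ)
    (hp : ∀ p ∈ r.premises, p.subst σ ∈ S) : G.IsInferredFrom S θ :=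
  hθ ▸ ⟨r, hG r hr, σ, rfl, hp⟩

/-- Premise obligations of a one-premise rule. [folklore] -/
theorem prems_one {P : PropForm ℕ → Prop} {p : PropForm ℕ} (h : P p) : ∀ q ∈ [p], P q := by
  intro q hq
  rw [List.mem_singleton] at hq
  subst hq
  exact h

/-- Premise obligations of a two-premise rule. [folklore] -/
theorem prems_two {P : PropForm ℕ → Prop} {p₁ p₂ : PropForm ℕ} (h₁ : P p₁) (h₂ : P p₂) :
    ∀ q ∈ [p₁, p₂], P q := by
  intro q hq
  rcases List.mem_cons.1 hq with rfl | hq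
  · exact h₁
  · rw [List.mem_singleton] at hq
    subst hq
    exact h₂

/-- Membership of the scaffold rules in `rules` (for `infer`). [folklore] -/
theorem mem_rules :
    rConjR ∈ rules ∧ rConjL ∈ rules ∧ rNegDisjL ∈ rules ∧ rNegDisjR ∈ rules ∧
      rCtxConjL ∈ rules ∧ rCtxConjR ∈ rules ∧ rWeak ∈ rules ∧ rBot ∈ rules ∧ rMP ∈ rules := by
  simp [rules]

/-- A list of lines each of which is available or inferred from `Γ` alone is a block.
[folklore] -/
theorem isBlock_of_forall {Γ : Set (PropForm ℕ)} {D : List (PropForm ℕ)}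
    (h : ∀ θ ∈ D, θ ∈ Γ ∨ G.IsInferredFrom Γ θ) : G.IsBlock Γ D := by
  induction D with
  | nil => exact FregeSystem.IsBlock.nil G Γ
  | cons θ D ih =>
    exact FregeSystem.IsBlock.cons (h θ List.mem_cons_self)
      ((ih fun χ hχ => h χ (List.mem_cons_of_mem _ hχ)).mono Set.subset_union_left)

/-- The peeling lines form a block over any set containing `κ ∨ ⋀l`. [folklore] -/
theorem isBlock_peel (hG : ∀ r ∈ rules, r ∈ G.rules) (κ : ℕ) :
    ∀ (l : List (PropForm ℕ)) (Γ : Set (PropForm ℕ)), disj (var κ) (bigAnd l) ∈ Γ →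
      G.IsBlock Γ (peel κ l)
  | [], Γ, _ => FregeSystem.IsBlock.nil G Γ
  | c :: l, Γ, h => by
    refine FregeSystem.IsBlock.cons (Or.inr ?_) (FregeSystem.IsBlock.cons (Or.inr ?_)
      (isBlock_peel hG κ l _ (by simp)))
    · exact infer hG rCtxConjL mem_rules.2.2.2.2.1 (sub [var κ, c, bigAnd l]) rfl
        (prems_one h)
    · exact infer hG rCtxConjR mem_rules.2.2.2.2.2.1 (sub [var κ, c, bigAnd l]) rfl
        (prems_one (Or.inl h))

/-- Every constraint line `κ ∨ c`, `c ∈ l`, occurs among the peeling lines. [folklore] -/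
theorem mem_peel {κ : ℕ} {c : PropForm ℕ} : ∀ {l : List (PropForm ℕ)}, c ∈ l → disj (var κ) c ∈ peel κ l
  | [], h => absurd h List.not_mem_nil
  | c' :: l, h => by
    rcases List.mem_cons.1 h with rfl | h
    · exact List.mem_cons_self
    · exact List.mem_cons_of_mem _ (List.mem_cons_of_mem _ (mem_peel h))

/-- The lines of `prefixBlock` form a block over the extension axioms. [folklore] -/
theorem isBlock_prefixBlock (hG : ∀ r ∈ rules, r ∈ G.rules) (T₀ T₁ : List (PropForm ℕ)) (κ : ℕ)
    (E : List (ℕ × PropForm ℕ)) :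
    G.IsBlock {χ | χ ∈ FregeSystem.extAxioms ((κ, target T₀ T₁) :: E)} (prefixBlock T₀ T₁ κ E) := by
  set Φ := target T₀ T₁ with hΦ
  set Γ₀ : Set (PropForm ℕ) := {χ | χ ∈ FregeSystem.extAxioms ((κ, Φ) :: E)} with hΓ₀
  have hκΦ : biimp (var κ) Φ ∈ Γ₀ := by simp [hΓ₀, FregeSystem.extAxioms]
  have hext : ∀ e ∈ E, biimp (var e.1) e.2 ∈ Γ₀ := fun e he => by
    simp only [hΓ₀, FregeSystem.extAxioms, Set.mem_setOf_eq, List.map_cons, List.mem_cons,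
      List.mem_map]
    exact Or.inr ⟨e, he, rfl⟩
  -- `κ ∨ ¬Φ`
  refine FregeSystem.IsBlock.cons (Or.inr (infer hG rConjR mem_rules.1
    (sub [const true, disj (neg (var κ)) Φ, disj (var κ) (neg Φ)]) rfl
    (prems_one hκΦ))) ?_
  -- `κ ∨ ⋀T₀`, `κ ∨ ⋀T₁`
  refine FregeSystem.IsBlock.cons (Or.inr (infer hG rNegDisjL mem_rules.2.2.1
    (sub [var κ, bigAnd T₀, bigAnd T₁]) rfl
    (prems_one (Or.inr rfl)))) ?_
  refine FregeSystem.IsBlock.cons (Or.inr (infer hG rNegDisjR mem_rules.2.2.2.1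
    (sub [var κ, bigAnd T₀, bigAnd T₁]) rfl
    (prems_one (Or.inl (Or.inr rfl))))) ?_
  -- peeling both conjunctions, then contextualising the abbreviations
  rw [List.append_assoc]
  refine (isBlock_peel hG κ T₀ _ ?h0).append ((isBlock_peel hG κ T₁ _ ?h1).append
    (isBlock_of_forall fun θ hθ => ?h2))
  case h0 => exact Or.inl (Or.inr rfl)
  case h1 => exact Or.inl (Or.inr rfl)
  obtain ⟨e, he, rfl⟩ := List.mem_map.1 hθ
  refine Or.inr (infer hG rWeak mem_rules.2.2.2.2.2.2.1 (sub [var κ, biimp (var e.1) e.2]) rfl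
    (prems_one ?_))
  iterate 5 apply Or.inl
  exact hext e he

/-- The scaffold prefix is a relaxed extended Frege sequence (extension axioms, then a block
over them), provided `κ` lies above the variables of the target and `E` is well allocated
above `κ`. [cite: CookReckhow1979, Def. 4.1] -/
theorem isRelaxedEF_prefixLines (hG : ∀ r ∈ rules, r ∈ G.rules) {T₀ T₁ : List (PropForm ℕ)} {κ : ℕ}
    {E : List (ℕ × PropForm ℕ)} (hκ : (target T₀ T₁).bound ≤ κ)
    (hE : FregeSystem.IsExtList (κ + 1) E) : G.IsRelaxedEF (target T₀ T₁) (prefixLines T₀ T₁ κ E) := by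
  refine (FregeSystem.isRelaxedEF_extAxioms hκ ⟨?_, ?_, ?_⟩).append_block
    (isBlock_prefixBlock hG T₀ T₁ κ E)
  · intro e he
    rcases List.mem_cons.1 he with rfl | he
    · exact le_rfl
    · exact Nat.le_of_succ_le (hE.1 e he)
  · exact List.pairwise_cons.2 ⟨fun e he => hE.1 e he, hE.2.1⟩
  · intro e he
    rcases List.mem_cons.1 he with rfl | he
    · exact hκ
    · exact hE.2.2 e he

/-- The available set offered to the user consists of lines of the scaffold prefix.
[folklore] -/
theorem avail_subset (T₀ T₁ : List (PropForm ℕ)) (κ : ℕ) (E : List (ℕ × PropForm ℕ)) :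
    Avail T₀ T₁ κ E ⊆ {χ | χ ∈ prefixLines T₀ T₁ κ E} := by
  rintro θ (⟨c, hc, rfl⟩ | ⟨e, he, rfl⟩) <;>
    simp only [prefixLines, prefixBlock, Set.mem_setOf_eq, List.mem_append, List.mem_cons]
  · rcases List.mem_append.1 hc with hc | hc
    · exact Or.inr (Or.inr (Or.inr (Or.inr (Or.inl (Or.inl (mem_peel hc))))))
    · exact Or.inr (Or.inr (Or.inr (Or.inr (Or.inl (Or.inr (mem_peel hc))))))
  · exact Or.inr (Or.inr (Or.inr (Or.inr (Or.inr (List.mem_map.2 ⟨e, he, rfl⟩)))))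

/-- **The scaffold theorem.** Let `G` contain the scaffold rules, let `κ` lie above all
variables of `Φ = ¬⋀T₀ ∨ ¬⋀T₁`, let the abbreviations `E` be well allocated above `κ`, and let
`D` be a block over the available lines `κ ∨ c` (`c ∈ T₀ ++ T₁`), `κ ∨ (p ↔ χ)`
(`(p, χ) ∈ E`) containing the line `κ ∨ ⊥`. Then `Φ` has an extended Frege proof over `G` of
size at most that of the scaffold lines plus `proofSize D`.
[cite: CookReckhow1979, Def. 4.1] [cite: CookReckhow1979, Thm. 2.3 (proof)] -/
theorem exists_isEFProofOf (hG : ∀ r ∈ rules, r ∈ G.rules) {T₀ T₁ : List (PropForm ℕ)} {κ : ℕ}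
    {E : List (ℕ × PropForm ℕ)} {D : List (PropForm ℕ)} (hκ : (target T₀ T₁).bound ≤ κ)
    (hE : FregeSystem.IsExtList (κ + 1) E) (hD : G.IsBlock (Avail T₀ T₁ κ E) D)
    (hbot : disj (var κ) (const false) ∈ D) :
    ∃ π : List (PropForm ℕ), G.IsEFProofOf π (target T₀ T₁) ∧
      proofSize π ≤ proofSize (prefixLines T₀ T₁ κ E) + proofSize D +
        proofSize (suffixLines T₀ T₁ κ) := by
  set Φ := target T₀ T₁ with hΦ
  have hpre := isRelaxedEF_prefixLines hG hκ hE
  have hD' : G.IsBlock {χ | χ ∈ prefixLines T₀ T₁ κ E} D := hD.mono (avail_subset T₀ T₁ κ E)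
  have h₂ := hpre.append_block hD'
  have hκΦ : biimp (var κ) Φ ∈ prefixLines T₀ T₁ κ E ++ D := by
    simp [prefixLines, FregeSystem.extAxioms, hΦ]
  have hbot' : disj (var κ) (const false) ∈ prefixLines T₀ T₁ κ E ++ D :=
    List.mem_append_right _ hbot
  have hsuf : G.IsBlock {χ | χ ∈ prefixLines T₀ T₁ κ E ++ D} (suffixLines T₀ T₁ κ) := by
    refine FregeSystem.IsBlock.cons (Or.inr (infer hG rBot mem_rules.2.2.2.2.2.2.2.1
      (sub [var κ]) rfl
      (prems_one hbot'))) ?_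
    refine FregeSystem.IsBlock.cons (Or.inr (infer hG rConjL mem_rules.2.1
      (sub [const true, disj (neg (var κ)) Φ, disj (var κ) (neg Φ)]) rfl
      (prems_one (Or.inl hκΦ)))) ?_
    refine FregeSystem.IsBlock.singleton (Or.inr (infer hG rMP mem_rules.2.2.2.2.2.2.2.2
      (sub [const true, var κ, Φ]) rfl (prems_two (Or.inl (Or.inr rfl)) (Or.inr rfl))))
  have h₃ := h₂.append_block hsuf
  obtain ⟨π, hπ, hsize⟩ := h₃.exists_isEFProofOf (by simp [suffixLines])
  refine ⟨π, hπ, hsize.trans (le_of_eq ?_)⟩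
  simp only [proofSize_append]

/-! #### Size of the scaffold -/

/-- `proofSize` of a cons. [folklore] -/
theorem proofSize_cons (θ : PropForm ℕ) (π : List (PropForm ℕ)) :
    proofSize (θ :: π) = θ.size + proofSize π := by
  simp [proofSize]

/-- Size of the target formula. [folklore] -/
theorem size_target (T₀ T₁ : List (PropForm ℕ)) :
    (target T₀ T₁).size = (bigAnd T₀).size + (bigAnd T₁).size + 3 := by
  simp only [target, size]
  ring

/-- A conjunct is smaller than the big conjunction. [folklore] -/
theorem size_le_size_bigAnd {l : List (PropForm ℕ)} {c : PropForm ℕ} (h : c ∈ l) :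
    c.size ≤ (bigAnd l).size := by
  induction l with
  | nil => simp at h
  | cons c' l ih =>
    simp only [bigAnd, size]
    rcases List.mem_cons.1 h with rfl | h
    · omega
    · have := ih h
      omega

/-- Size of the peeling lines: `2·|l|` lines of size at most `|⋀l| + 2`. [folklore] -/
theorem proofSize_peel_le (κ : ℕ) (l : List (PropForm ℕ)) :
    proofSize (peel κ l) ≤ 2 * l.length * ((bigAnd l).size + 2) := by
  induction l with
  | nil => simp [peel, proofSize]
  | cons c l ih =>
    simp only [peel, proofSize_cons, size, List.length_cons, bigAnd]
    have hc : (bigAnd l).size ≤ c.size + (bigAnd l).size + 1 := by omega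
    nlinarith [ih, hc]

/-- An explicit bound for the size of the scaffold lines (everything but the user's block):
linear in `(|T₀| + |T₁|) · |Φ|` and in the total size of the abbreviations. [folklore] -/
def sizeBound (T₀ T₁ : List (PropForm ℕ)) (E : List (ℕ × PropForm ℕ)) : ℕ :=
  (2 * (T₀.length + T₁.length) + 7) * ((target T₀ T₁).size + 3) +
    4 * (E.map fun e => e.2.size + 4).sum

/-- Size of the contextualised abbreviations. [folklore] -/
theorem proofSize_map_ctx (κ : ℕ) (E : List (ℕ × PropForm ℕ)) :
    proofSize (E.map fun e => disj (var κ) (biimp (var e.1) e.2)) =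
      (E.map fun e => 2 * e.2.size + 9).sum := by
  induction E with
  | nil => rfl
  | cons e E ih =>
    simp only [List.map_cons, proofSize_cons, size, FregeSystem.size_biimp] at ih ⊢
    rw [ih, List.sum_cons]
    ring

/-- The scaffold lines are within `sizeBound`. [folklore] -/
theorem proofSize_scaffold_le (T₀ T₁ : List (PropForm ℕ)) (κ : ℕ) (E : List (ℕ × PropForm ℕ)) :
    proofSize (prefixLines T₀ T₁ κ E) + proofSize (suffixLines T₀ T₁ κ) ≤ sizeBound T₀ T₁ E := by
  have h₀ := proofSize_peel_le κ T₀
  have h₁ := proofSize_peel_le κ T₁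
  have hT := size_target T₀ T₁
  have hE : (E.map fun e => 2 * e.2.size + 7).sum + (E.map fun e => 2 * e.2.size + 9).sum =
      4 * (E.map fun e => e.2.size + 4).sum := by
    induction E with
    | nil => rfl
    | cons e E ih =>
      simp only [List.map_cons, List.sum_cons]
      omega
  simp only [prefixLines, prefixBlock, suffixLines, FregeSystem.extAxioms, List.map_cons,
    proofSize_append, proofSize_cons, proofSize_nil, FregeSystem.size_biimp, size,
    proofSize_map_ctx, sizeBound]
  rw [← FregeSystem.extAxioms, FregeSystem.proofSize_extAxioms]
  have hB₀ : (bigAnd T₀).size + 2 ≤ (target T₀ T₁).size + 3 := by omega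
  have hB₁ : (bigAnd T₁).size + 2 ≤ (target T₀ T₁).size + 3 := by omega
  have h₀' : proofSize (peel κ T₀) ≤ 2 * T₀.length * ((target T₀ T₁).size + 3) :=
    h₀.trans (Nat.mul_le_mul_left _ hB₀)
  have h₁' : proofSize (peel κ T₁) ≤ 2 * T₁.length * ((target T₀ T₁).size + 3) :=
    h₁.trans (Nat.mul_le_mul_left _ hB₁)
  nlinarith [h₀', h₁', hE, hT]

/-- **The scaffold theorem with an explicit size bound**: under the hypotheses of
`exists_isEFProofOf`, the target has an extended Frege proof over `G` of size at most
`sizeBound T₀ T₁ E + proofSize D`. [cite: CookReckhow1979, Def. 4.1] [cite: CookReckhow1979, Thm. 2.3 (proof)] -/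
theorem exists_isEFProofOf_le (hG : ∀ r ∈ rules, r ∈ G.rules) {T₀ T₁ : List (PropForm ℕ)} {κ : ℕ}
    {E : List (ℕ × PropForm ℕ)} {D : List (PropForm ℕ)} (hκ : (target T₀ T₁).bound ≤ κ)
    (hE : FregeSystem.IsExtList (κ + 1) E) (hD : G.IsBlock (Avail T₀ T₁ κ E) D)
    (hbot : disj (var κ) (const false) ∈ D) :
    ∃ π : List (PropForm ℕ), G.IsEFProofOf π (target T₀ T₁) ∧
      proofSize π ≤ sizeBound T₀ T₁ E + proofSize D := by
  obtain ⟨π, hπ, hsize⟩ := exists_isEFProofOf hG hκ hE hD hbot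
  refine ⟨π, hπ, hsize.trans ?_⟩
  have := proofSize_scaffold_le T₀ T₁ κ E
  omega

end Scaffold

end Literature.Computability.MetaComplexity
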